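import Summits.BirchSwinnertonDyer.BirchSwinnertonDyer.Theorems.ResidualThetaTransportAtTwoThetaLayerLambdaCongruenceAtTwoHeckeAdjointTranspose
import Summits.BirchSwinnertonDyer.BirchSwinnertonDyer.Theorems.ResidualThetaTransportAtTwoThetaLayerLambdaCongruenceAtTwoOfSdBz
import HarnessLib

/-!
# Crux Kan⁺ `ThetaLayerLambdaCongruenceAtTwo` (stmt-BirchSwinnertonDyer-20688), line `birth` v14, SD floor: the Hecke self-duality
# input SD is now a THEOREM, and the crux BY NAME from Buzzard 2000 Prop. 2.4 ALONE
# (width seat bsd-wall-rtt-p3-w3 g11; `--supports stmt-BirchSwinnertonDyer-20688`; THEOREMS ONLY — no `def`, no `sorry`)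

HONEST FRAMING. With IP (`periodHomology_exists_heckeSelfAdjoint_perfectPairing`) proved in kernel by the team's bricks HA1–HA8
(`ip_of_crossingPairing_flagSides`, file `…HeckeAdjointTranspose`), the print input SD = `heckeSelfDual_torsionBy_J0` (Hecke self-duality of
`J₀(N)[ℓ]`, Darmon–Diamond–Taylor §1.6–1.7) follows by rtt-p3-w4's `heckeSelfDual_torsionBy_J0_of_perfectPairing`, and the crux Kan⁺ is
CONDITIONAL on exactly ONE print fact: Buzzard 2000 Prop. 2.4 (`buzzard2000_multiplicityOne_gamma0`, alias item 27798). Kan⁺ is NOT settled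
by this file; BSD is not proved by any of this.

References: H. Darmon, F. Diamond, R. Taylor, Fermat's Last Theorem (1995), §1.6 Lemma 1.38, §4.5 [DarmonDiamondTaylor1995]; L. Merel (1995),
§1.2–1.3, §2.1–2.3 [Merel1995Homologie]; K. Buzzard, On level-lowering for mod 2 representations (2000), Prop. 2.4 [Buzzard2000LevelLoweringModTwo].
-/

set_option autoImplicit false

noncomputable section

-- justification: the `Summit.BirchSwinnertonDyer.BirchSwinnertonDyer.…` path repeats a component (route-file convention)
set_option linter.dupNamespace false

open Literature.NumberTheory.EllipticCurves.ModularForms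
  Summit.BirchSwinnertonDyer.BirchSwinnertonDyer.Theses.ResidualThetaTransportAtTwo

namespace Summit.BirchSwinnertonDyer.BirchSwinnertonDyer.Theorems.ThetaLayerLambdaCongruenceAtTwo

/-- **SD is a theorem.** The print input `heckeSelfDual_torsionBy_J0` (Hecke self-duality of the `ℓ`-torsion of `J₀(N)` for every `N ≥ 1` and
prime `ℓ`, as typed in the tree) holds: IP (`ip_of_crossingPairing_flagSides`) fed to `heckeSelfDual_torsionBy_J0_of_perfectPairing`.
[cite: DarmonDiamondTaylor1995, §1.6 Lemma 1.38 and §4.5] [cite: Merel1995Homologie, §1.2–1.3 and §2.1–2.3] -/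
theorem heckeSelfDual_torsionBy_J0_of_flagSides : heckeSelfDual_torsionBy_J0 :=
  heckeSelfDual_torsionBy_J0_of_perfectPairing ip_of_crossingPairing_flagSides

/-- **Kan⁺ `ThetaLayerLambdaCongruenceAtTwo` BY NAME from Buzzard 2000 Prop. 2.4 ALONE** (`thetaLayerLambdaCongruenceAtTwo_of_ipBz` with IP
discharged). CONDITIONAL on the one print fact `buzzard2000_multiplicityOne_gamma0`; BSD is not proved by this.
[cite: Buzzard2000LevelLoweringModTwo, Prop. 2.4] [cite: Pollack2003, Conj. 6.3 and Prop. 6.18] -/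
theorem thetaLayerLambdaCongruenceAtTwo_of_bz (hBz : buzzard2000_multiplicityOne_gamma0) : ThetaLayerLambdaCongruenceAtTwo :=
  thetaLayerLambdaCongruenceAtTwo_of_ipBz ip_of_crossingPairing_flagSides hBz

/-- **Kan⁺ BY NAME from the single alias ITEM 27798 `BuzzardMultiplicityOneGammaZeroInput`** (route declaration; no bundle, no other input).
CONDITIONAL; BSD is not proved by this. [cite: Buzzard2000LevelLoweringModTwo, Prop. 2.4] -/
theorem thetaLayerLambdaCongruenceAtTwo_of_buzzardInput (h27798 : BuzzardMultiplicityOneGammaZeroInput) : ThetaLayerLambdaCongruenceAtTwo :=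
  thetaLayerLambdaCongruenceAtTwo_of_bz h27798

end Summit.BirchSwinnertonDyer.BirchSwinnertonDyer.Theorems.ThetaLayerLambdaCongruenceAtTwo

end
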